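import Summits.QuantumAdvantage.QuantumAdvantage.Theorems.RankDialA

/-!
# RankDial (B) — part 2/4: the FIBRE THEOREM for general tables

TARGET BY NAME (cell decomp-qadv, RESIDUAL MODE): item stmt-QuantumAdvantage-23109
`Summit.QuantumAdvantage.QuantumAdvantage.Theses.OddPrimeWalk.ManyReadersSqrtOdd` (=: T), reached through rung R5 =
`AdviceFreeQNC0.WalkHardFLinSel p` (`T → ∀ p ≥ 5, R5 p`, tree `JLinPeel`).  These files SUPPORT the item (`--supports`); they do not close it.

`window_bound_of_equiRank : EquiRank p r → ∃ ℓ₀, ∀ L ℓ R, ℓ₀ ≤ ℓ → ∀ c y, CutFree y L ℓ → RankLE p y (r ℓ) → 24·#WIN ≤ 19·2^(L+ℓ+R)`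
(+ `_real`, `_equiRankLin`).  Mechanism [g24 frame, generalised from readership to rank]: on an outside fibre `(a,b)` the cuts live at
class `r'` are determined by the outside data, the class-`r'` fire count is a parity of `#{g live : T_g(Φv)}` = a function `G_(r')(Φv)`
of the sketch (`fireCount`, `ringWinU_iff_fireCount`, `sum_fireCount`), at most two of the three classes win at any `v`
(`not_three_odd`, `sum_three_classes_le`), and `EquiRank` makes each winning level set carry `≤ 1/3 + 1/24` of each weight class;
Fubini over the fibres (`card_win_fibre_eq`, tree `card_filter_eq_sum_glue3`).
-/

set_option linter.dupNamespace false
set_option autoImplicit false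

noncomputable section
open Classical

namespace Summit.QuantumAdvantage.QuantumAdvantage.Theorems.RankDial

open Finset
open Summit.QuantumAdvantage.AdviceFreeQNC0

/-! ### §3 The fibre theorem for GENERAL tables: `EquiRank` ⟹ low-rank cut-free-window strategies lose -/

section Fibre
variable {L ℓ R : ℕ} (c : ℕ) (y : Fin (L + ℓ + R + 1) → (Fin (L + ℓ + R) → Bool) → Bool)

/-- [g24] Number of cuts firing at `a ++ v ++ b` whose character, with the window weight replaced by the parameter
`r`, is live (`≢ 0 mod 3`). -/
def fireCount (a : Fin L → Bool) (b : Fin R → Bool) (r : ℕ) (v : Fin ℓ → Bool) : ℕ :=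
  (univ.filter fun g : Fin (L + ℓ + R + 1) =>
    y g (glue3 a v b) = true ∧ gapChar ℓ c a b g.val r % 3 ≠ 0).card

/-- [g24] -/
theorem fireCount_mod (a : Fin L → Bool) (b : Fin R → Bool) (r : ℕ) (v : Fin ℓ → Bool) :
    fireCount c y a b r v = fireCount c y a b (r % 3) v := by
  unfold fireCount
  congr 1
  refine Finset.filter_congr fun g _ => ?_
  rw [gapChar_mod ℓ c a b g.val r]

/-- [g24] **The win bit through the window weight** (cut-free window, the window MAY be read):
`WIN(a ++ v ++ b) ⟺ fireCount(|v|, v)` odd. -/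
theorem ringWinU_iff_fireCount (hgap : CutFree y L ℓ) (a : Fin L → Bool) (v : Fin ℓ → Bool) (b : Fin R → Bool) :
    ringWinU c y (glue3 a v b) = true ↔ fireCount c y a b (wt v) v % 2 = 1 := by
  unfold ringWinU fireCount
  rw [decide_eq_true_iff]
  have hset : (univ.filter fun g : Fin (L + ℓ + R + 1) =>
      y g (glue3 a v b) = true ∧ (c + g.val + walkExp (glue3 a v b) g.val) % 3 ≠ 0) =
      univ.filter fun g : Fin (L + ℓ + R + 1) =>
        y g (glue3 a v b) = true ∧ gapChar ℓ c a b g.val (wt v) % 3 ≠ 0 := by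
    refine Finset.filter_congr fun g _ => ?_
    have hout : y g (glue3 a v b) = true → (g.val ≤ L ∨ L + ℓ ≤ g.val) := by
      intro h1
      by_contra hcon
      push Not at hcon
      have hf := hgap g hcon.1 hcon.2 (glue3 a v b)
      rw [hf] at h1
      exact Bool.false_ne_true h1
    have hchar : (g.val ≤ L ∨ L + ℓ ≤ g.val) →
        c + g.val + walkExp (glue3 a v b) g.val = gapChar ℓ c a b g.val (wt v) := by
      intro hg
      unfold walkExp gapChar
      by_cases hle : g.val ≤ L
      · rw [if_pos hle, wtPrefix_glue3_of_le a v b hle, wt_glue3]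
      · rw [if_neg hle, wtPrefix_glue3_of_ge a v b (hg.resolve_left hle), wt_glue3]
    constructor
    · rintro ⟨h1, h2⟩
      exact ⟨h1, by rwa [← hchar (hout h1)]⟩
    · rintro ⟨h1, h2⟩
      exact ⟨h1, by rwa [hchar (hout h1)]⟩
  rw [hset]

/-- [g24] Each firing cut is live at EXACTLY two of the three speed classes. -/
theorem sum_fireCount (a : Fin L → Bool) (b : Fin R → Bool) (v : Fin ℓ → Bool) :
    ∑ r ∈ range 3, fireCount c y a b r v =
      (univ.filter fun g : Fin (L + ℓ + R + 1) => y g (glue3 a v b) = true).card * 2 := by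
  set S := univ.filter fun g : Fin (L + ℓ + R + 1) => y g (glue3 a v b) = true with hS
  have hcount : ∀ r, fireCount c y a b r v =
      ∑ g ∈ S, (if gapChar ℓ c a b g.val r % 3 ≠ 0 then 1 else 0) := by
    intro r
    unfold fireCount
    rw [hS, Finset.sum_filter, Finset.card_filter]
    refine Finset.sum_congr rfl fun g _ => ?_
    by_cases h1 : y g (glue3 a v b) = true <;> by_cases h2 : gapChar ℓ c a b g.val r % 3 ≠ 0 <;> simp [h1, h2]
  simp_rw [hcount]
  rw [Finset.sum_comm, Finset.sum_congr rfl fun g _ => sum_range_three_gapChar_ne ℓ c a b g.val,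
    Finset.sum_const, smul_eq_mul]

/-- [g24] Hence the three class parities cannot all be odd at the same window content. -/
theorem not_three_odd (a : Fin L → Bool) (b : Fin R → Bool) (v : Fin ℓ → Bool) :
    ¬ (fireCount c y a b 0 v % 2 = 1 ∧ fireCount c y a b 1 v % 2 = 1 ∧ fireCount c y a b 2 v % 2 = 1) := by
  have h := sum_fireCount c y a b v
  rw [Finset.sum_range_succ, Finset.sum_range_succ, Finset.sum_range_succ, Finset.sum_range_zero] at h
  omega

/-- [g24] **At most two classes win**: `Σ_{r<3} #{v : fireCount(r, v) odd} ≤ 2·2^ℓ`. -/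
theorem sum_three_classes_le (a : Fin L → Bool) (b : Fin R → Bool) :
    ∑ r ∈ range 3, (univ.filter fun v : Fin ℓ → Bool => fireCount c y a b r v % 2 = 1).card ≤ 2 * 2 ^ ℓ := by
  have hv : ∀ v : Fin ℓ → Bool,
      ∑ r ∈ range 3, (if fireCount c y a b r v % 2 = 1 then 1 else 0) ≤ 2 := by
    intro v
    have h := not_three_odd c y a b v
    rw [Finset.sum_range_succ, Finset.sum_range_succ, Finset.sum_range_succ, Finset.sum_range_zero]
    by_cases h0 : fireCount c y a b 0 v % 2 = 1 <;> by_cases h1 : fireCount c y a b 1 v % 2 = 1 <;>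
      by_cases h2 : fireCount c y a b 2 v % 2 = 1
    · exact absurd ⟨h0, h1, h2⟩ h
    all_goals simp [h0, h1, h2]
  simp_rw [Finset.card_filter]
  rw [Finset.sum_comm]
  calc ∑ v : Fin ℓ → Bool, ∑ r ∈ range 3, (if fireCount c y a b r v % 2 = 1 then 1 else 0)
      ≤ ∑ _v : Fin ℓ → Bool, 2 := Finset.sum_le_sum fun v _ => hv v
    _ = 2 * 2 ^ ℓ := by
      rw [Finset.sum_const, Finset.card_univ, Fintype.card_fun, Fintype.card_bool, Fintype.card_fin,
        smul_eq_mul, mul_comm]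

/-- [g24] The fibre win count splits over the three residue classes of `|v|`. -/
theorem card_win_fibre_eq (hgap : CutFree y L ℓ) (a : Fin L → Bool) (b : Fin R → Bool) :
    (univ.filter fun v : Fin ℓ → Bool => ringWinU c y (glue3 a v b) = true).card =
      ∑ r ∈ range 3, (univ.filter fun v : Fin ℓ → Bool => wt v % 3 = r ∧ fireCount c y a b r v % 2 = 1).card := by
  rw [Finset.card_eq_sum_card_fiberwise (f := fun v : Fin ℓ → Bool => wt v % 3) (t := range 3)
    (fun v _ => Finset.mem_range.2 (Nat.mod_lt _ (by norm_num)))]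
  refine Finset.sum_congr rfl fun r _ => ?_
  rw [Finset.filter_filter]
  congr 1
  refine Finset.filter_congr fun v _ => ?_
  constructor
  · rintro ⟨hw, hr'⟩
    refine ⟨hr', ?_⟩
    rw [ringWinU_iff_fireCount c y hgap, fireCount_mod, hr'] at hw
    exact hw
  · rintro ⟨hr', hw⟩
    refine ⟨?_, hr'⟩
    rw [ringWinU_iff_fireCount c y hgap, fireCount_mod, hr']
    exact hw

/-- **THE FIBRE THEOREM (general tables).**  `EquiRank p r` ⟹ every strategy on `n = L + ℓ + R` bits (selector
tables ARBITRARY) with the window `[L, L+ℓ)` cut-free and of `𝔽_p`-sketch dimension `≤ r(ℓ)` wins on at most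
`(19/24)·2ⁿ` inputs: `24·#WIN ≤ 19·2ⁿ` (`ℓ ≥ ℓ₀(r)`).  Fibrewise: the class-`r'` fire parity is `G_{r'}(Φv)` with
`G_{r'}(x) = ` parity of `#{g live at r' : T_g(x)}`; `24·#win ≤ 8·Σ_{r'} #{G_{r'}∘Φ odd} + 3·2^ℓ ≤ 19·2^ℓ`. -/
theorem window_bound_of_equiRank {p : ℕ} {r : ℕ → ℕ} (hE : EquiRank p r) :
    ∃ ℓ₀ : ℕ, ∀ (L ℓ R : ℕ), ℓ₀ ≤ ℓ →
      ∀ (c : ℕ) (y : Fin (L + ℓ + R + 1) → (Fin (L + ℓ + R) → Bool) → Bool),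
        CutFree y L ℓ → RankLE p y (r ℓ) →
        24 * (univ.filter fun u : Fin (L + ℓ + R) → Bool => ringWinU c y u = true).card ≤ 19 * 2 ^ (L + ℓ + R) := by
  obtain ⟨ℓ₀, hEq⟩ := hE
  refine ⟨ℓ₀, fun L ℓ R hℓ c y hgap hrank => ?_⟩
  obtain ⟨d, hd, Φ, hΦ⟩ := hrank
  choose T hT using hΦ
  -- fibrewise bound
  have hfib : ∀ (a : Fin L → Bool) (b : Fin R → Bool),
      24 * (univ.filter fun v : Fin ℓ → Bool => ringWinU c y (glue3 a v b) = true).card ≤ 19 * 2 ^ ℓ := by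
    intro a b
    rw [card_win_fibre_eq c y hgap a b, Finset.mul_sum]
    have hclass : ∀ r' ∈ range 3,
        24 * (univ.filter fun v : Fin ℓ → Bool => wt v % 3 = r' ∧ fireCount c y a b r' v % 2 = 1).card ≤
          8 * (univ.filter fun v : Fin ℓ → Bool => fireCount c y a b r' v % 2 = 1).card + 2 ^ ℓ := by
      intro r' hr'
      have hr3 : r' < 3 := Finset.mem_range.1 hr'
      -- the class fire count is a function of the sketch
      have hfc : ∀ v : Fin ℓ → Bool, fireCount c y a b r' v =
          (univ.filter fun g : Fin (L + ℓ + R + 1) =>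
            T g a b (fun k => ∑ j, if v j then Φ k j else 0) = true ∧ gapChar ℓ c a b g.val r' % 3 ≠ 0).card := by
        intro v
        unfold fireCount
        congr 1
        exact Finset.filter_congr fun g _ => by rw [hT g a b v]
      have hset1 : (univ.filter fun v : Fin ℓ → Bool => wt v % 3 = r' ∧ fireCount c y a b r' v % 2 = 1) =
          univ.filter fun v : Fin ℓ → Bool => wt v % 3 = r' % 3 ∧
            (fun x : Fin d → ZMod p => decide ((univ.filter fun g : Fin (L + ℓ + R + 1) =>
              T g a b x = true ∧ gapChar ℓ c a b g.val r' % 3 ≠ 0).card % 2 = 1))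
              (fun k => ∑ j, if v j then Φ k j else 0) = true := by
        refine Finset.filter_congr fun v _ => ?_
        rw [Nat.mod_eq_of_lt hr3, hfc v, decide_eq_true_iff]
      have hset2 : (univ.filter fun v : Fin ℓ → Bool => fireCount c y a b r' v % 2 = 1) =
          univ.filter fun v : Fin ℓ → Bool =>
            (fun x : Fin d → ZMod p => decide ((univ.filter fun g : Fin (L + ℓ + R + 1) =>
              T g a b x = true ∧ gapChar ℓ c a b g.val r' % 3 ≠ 0).card % 2 = 1))
              (fun k => ∑ j, if v j then Φ k j else 0) = true := by
        refine Finset.filter_congr fun v _ => ?_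
        rw [hfc v, decide_eq_true_iff]
      rw [hset1, hset2]
      exact hEq ℓ hℓ d hd Φ (fun x : Fin d → ZMod p => decide ((univ.filter fun g : Fin (L + ℓ + R + 1) =>
              T g a b x = true ∧ gapChar ℓ c a b g.val r' % 3 ≠ 0).card % 2 = 1)) r' true
    calc ∑ r' ∈ range 3, 24 * (univ.filter fun v : Fin ℓ → Bool =>
            wt v % 3 = r' ∧ fireCount c y a b r' v % 2 = 1).card
        ≤ ∑ r' ∈ range 3, (8 * (univ.filter fun v : Fin ℓ → Bool => fireCount c y a b r' v % 2 = 1).card + 2 ^ ℓ) :=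
          Finset.sum_le_sum hclass
      _ = 8 * ∑ r' ∈ range 3, (univ.filter fun v : Fin ℓ → Bool => fireCount c y a b r' v % 2 = 1).card
            + 3 * 2 ^ ℓ := by
          rw [Finset.sum_add_distrib, Finset.mul_sum, Finset.sum_const, Finset.card_range, smul_eq_mul]
      _ ≤ 8 * (2 * 2 ^ ℓ) + 3 * 2 ^ ℓ := by
          have := sum_three_classes_le c y a b
          omega
      _ = 19 * 2 ^ ℓ := by ring
  -- Fubini over the outside blocks [g24]
  rw [card_filter_eq_sum_glue3 (fun w => ringWinU c y w = true), Finset.mul_sum]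
  calc ∑ a : Fin L → Bool, 24 * ∑ b : Fin R → Bool,
        (univ.filter fun v : Fin ℓ → Bool => ringWinU c y (glue3 a v b) = true).card
      ≤ ∑ _a : Fin L → Bool, 2 ^ R * (19 * 2 ^ ℓ) := by
        refine Finset.sum_le_sum fun a _ => ?_
        rw [Finset.mul_sum]
        calc ∑ b : Fin R → Bool, 24 * (univ.filter fun v : Fin ℓ → Bool => ringWinU c y (glue3 a v b) = true).card
            ≤ ∑ _b : Fin R → Bool, 19 * 2 ^ ℓ := Finset.sum_le_sum fun b _ => hfib a b
          _ = 2 ^ R * (19 * 2 ^ ℓ) := by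
            rw [Finset.sum_const, Finset.card_univ, Fintype.card_fun, Fintype.card_bool, Fintype.card_fin,
              smul_eq_mul]
    _ = 2 ^ L * (2 ^ R * (19 * 2 ^ ℓ)) := by
        rw [Finset.sum_const, Finset.card_univ, Fintype.card_fun, Fintype.card_bool, Fintype.card_fin,
          smul_eq_mul]
    _ = 19 * 2 ^ (L + ℓ + R) := by rw [pow_add, pow_add]; ring

/-- The fibre theorem as a real fraction: `#WIN ≤ (19/24)·2ⁿ`. -/
theorem window_bound_of_equiRank_real {p : ℕ} {r : ℕ → ℕ} (hE : EquiRank p r) :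
    ∃ ℓ₀ : ℕ, ∀ (L ℓ R : ℕ), ℓ₀ ≤ ℓ →
      ∀ (c : ℕ) (y : Fin (L + ℓ + R + 1) → (Fin (L + ℓ + R) → Bool) → Bool),
        CutFree y L ℓ → RankLE p y (r ℓ) →
        ((univ.filter fun u : Fin (L + ℓ + R) → Bool => ringWinU c y u = true).card : ℝ) ≤
          (19 / 24 : ℝ) * (2 : ℝ) ^ (L + ℓ + R) := by
  obtain ⟨ℓ₀, h⟩ := window_bound_of_equiRank hE
  refine ⟨ℓ₀, fun L ℓ R hℓ c y hgap hrank => ?_⟩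
  have h' := h L ℓ R hℓ c y hgap hrank
  have h'' : (24 : ℝ) * ((univ.filter fun u : Fin (L + ℓ + R) → Bool => ringWinU c y u = true).card : ℝ) ≤
      19 * (2 : ℝ) ^ (L + ℓ + R) := by exact_mod_cast h'
  linarith

/-- **The general-table theorem at the proved rung**: `EquiRankLin p` ⟹ for SOME `E`, every strategy (tables
arbitrary) with a cut-free window of sketch dimension `≤ ℓ/E`, `ℓ ≥ ℓ₀`, wins on `≤ (19/24)·2ⁿ` inputs. -/
theorem window_bound_of_equiRankLin {p : ℕ} (h : EquiRankLin p) :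
    ∃ E : ℕ, 0 < E ∧ ∃ ℓ₀ : ℕ, ∀ (L ℓ R : ℕ), ℓ₀ ≤ ℓ →
      ∀ (c : ℕ) (y : Fin (L + ℓ + R + 1) → (Fin (L + ℓ + R) → Bool) → Bool),
        CutFree y L ℓ → RankLE p y (ℓ / E) →
        ((univ.filter fun u : Fin (L + ℓ + R) → Bool => ringWinU c y u = true).card : ℝ) ≤
          (19 / 24 : ℝ) * (2 : ℝ) ^ (L + ℓ + R) := by
  obtain ⟨E, hE, hEq⟩ := h
  obtain ⟨ℓ₀, hW⟩ := window_bound_of_equiRank_real hEq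
  exact ⟨E, hE, ℓ₀, hW⟩

end Fibre

end Summit.QuantumAdvantage.QuantumAdvantage.Theorems.RankDial

end
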